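import Mathlib.MeasureTheory.Measure.SeparableMeasure
import Mathlib.MeasureTheory.Function.L2Space
import Mathlib.MeasureTheory.Function.ConvergenceInMeasure
import Mathlib.Analysis.SpecialFunctions.JapaneseBracket
import Mathlib.Analysis.InnerProductSpace.Projection.Minimal
import Mathlib.MeasureTheory.Integral.MeanInequalities
import Literature.Analysis.FunctionSpaces.SpaceTimeWeakCompactness
import Literature.Analysis.FluidPDE.NSLerayHopfSereginTraceProofs
import HarnessLib

/-!
# Weak compactness of `L³`-bounded sequences of fields on `ℝ³` (the datum extraction of the
local Leray limiting procedures)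

Analysis/FluidPDE support file, fully proved. Every limiting procedure of the local Leray theory
extracts from data bounded in `L³(ℝ³)` a weakly convergent subsequence and uses the weak lower
semicontinuity of the norm: Jia–Šverák 2013, proof of Thm. 1 (arXiv:1201.1592 p. 8: "`u₀^k ⇀ u₀`
in `L³(ℝ³)`", "`‖u₀‖_{L³} ≤ liminf ‖u₀^k‖_{L³}`"); Seregin 2012 §3 = Seregin 2014 Ch. 7 p. 135
("`w₀` is the weak `L₃(ℝ³)`-limit of the sequence `u^{(k)}(·, −S)`"); Lemarié-Rieusset 2016
p. 571 ("As `‖v_{n_k}(0, .)‖₃ ≤ M`, we find as well that `v_∞(0, .) ∈ L³`"). It is the datum clause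
of the named facts `localLeray_limiting_procedure` (`JiaSverak2013Compactness.lean`) and
`lemarieRieusset_localLeray_compactness` (`NSSereginMildFacts.lean`). This file **proves** it in
the tree's vocabulary (fields `ℝ³ → ℝ³`, `MemLp · 3 volume`, pairings `∫ ⟪a, φ⟫` with test fields
`FunctionSpaces.IsTestFunctionOn ⊤ φ`, `IsWeaklyDivFree`):

* `exists_strictMono_tendsto_integral_inner_of_eLpNorm_three_le` — from `a_k ∈ L³(ℝ³; ℝ³)` with
  `‖a_k‖₃ ≤ M`: a subsequence `σ` and `a' ∈ L³` with `‖a'‖₃ ≤ M` such that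
  `∫ ⟪a_{σ(k)}, φ⟫ → ∫ ⟪a', φ⟫` for every continuous compactly supported `φ`;
* `isWeaklyDivFree_of_tendsto_integral_inner` — weak limits of weakly divergence-free fields are
  weakly divergence free;
* `exists_strictMono_weakLimit_datum` — the two combined, in the exact shape of the datum clause
  of `jia_sverak_leray_weak_stability` / `localLeray_limiting_procedure`.

## The proof (Mathlib has no `L^p`–`L^q` duality and no reflexivity of `L^p` at this pin)

Through a Hilbert space: with the weight `w(x) = (1 + |x|)⁻⁴ ∈ L¹ ∩ L³(ℝ³)`, Hölder gives
`∫ w |f|² ≤ ‖f‖₃² ‖w‖₃`, so `L³(dx) ↪ H = L²(w dx)`, a separable Hilbert space (Mathlib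
`MeasureTheory.L2.innerProductSpace`, `Lp.SecondCountableTopology` for the `s`-finite measure
`w dx`). A bounded sequence in `H` has a weakly convergent subsequence (the tree's
`Literature.Analysis.FunctionSpaces.exists_strictMono_tendsto_inner_of_norm_le`, Brezis 2011
Thm. 3.18). The `L³`-ball `{f ∈ H : ‖f‖_{L³(dx)} ≤ M}` is convex (Minkowski) and closed in `H`
(`H`-convergence ⇒ convergence in measure ⇒ a.e. convergence of a subsequence, `w dx ∼ dx`, and
Fatou `Lp.eLpNorm_lim_le_liminf_eLpNorm`), hence weakly sequentially closed — proved here directly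
by the metric projection (`mem_of_tendsto_inner_of_convex_isClosed`: for the projection `p` of the
weak limit `b` onto the set, `⟪b − p, v_n − p⟫ ≤ 0` passes to the limit, `‖b − p‖² ≤ 0`; Brezis 2011
Thm. 3.7 / Thm. 5.2). Finally `⟪g, φ/w⟫_H = ∫ ⟪g, φ⟫ dx` for continuous compactly supported `φ`
(`φ/w` is bounded with compact support, `w dx` finite), which identifies weak convergence in `H`
with convergence of the pairings against such `φ`.

## Mathlib / tree search

Mathlib: `integrable_one_add_norm` (Japanese bracket), `withDensity_absolutelyContinuous'`,
`lintegral_withDensity_eq_lintegral_mul_non_measurable`, `integral_withDensity_eq_integral_smul`,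
`ENNReal.lintegral_mul_le_Lp_mul_Lq`, `exists_norm_eq_iInf_of_complete_convex`,
`norm_eq_iInf_iff_real_inner_le_zero`, `tendstoInMeasure_of_tendsto_Lp`,
`TendstoInMeasure.exists_seq_tendsto_ae`, `Lp.eLpNorm_lim_le_liminf_eLpNorm`,
`MeasureTheory.L2.inner_def`; nothing for `WeakSpace` sequential compactness or `Lp` duality
(`lean search 'weakly_convergent|BanachAlaoglu|Lp.*dual'`). Tree:
`exists_strictMono_tendsto_inner_of_norm_le` (`SpaceTimeWeakCompactness.lean`),
`isTestFunctionOn_gradient_top` (`NSLerayHopfSereginTraceProofs.lean`); the `Ḣ^{1/2}` analogue is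
`HomSobolevWeakLimits.lean`, the `L²`-tuple analogue `exists_subseq_weakLimit_of_sq_le`
(`NSLerayRegularisedLimitHolds.lean`).

## References

* H. Brezis, *Functional Analysis, Sobolev Spaces and Partial Differential Equations* (2011),
  Thm. 3.7 (closed convex sets are weakly closed), Prop. 3.5 (iii), Thm. 3.18, Thm. 5.2.
* H. Jia, V. Šverák, SIAM J. Math. Anal. 45 (2013) = arXiv:1201.1592, proof of Thm. 1, p. 8.
* G. Seregin, *Lecture Notes on Regularity Theory for the Navier–Stokes Equations* (2014), Ch. 7,
  p. 135 (PDF); Comm. Math. Phys. 312 (2012), §3.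
* P. G. Lemarié-Rieusset, *The Navier–Stokes Problem in the 21st Century* (2016), p. 571 (PDF).
-/

noncomputable section

open MeasureTheory TopologicalSpace Set Function Filter Metric
open _root_.Topology
open scoped ENNReal NNReal RealInnerProductSpace

namespace Literature.Analysis.FluidPDE

local notation "ℝ³" => EuclideanSpace ℝ (Fin 3)

/-! ### Weak limits stay in closed convex sets (Hilbert space) -/

/-- **Weak sequential limits of a closed convex set stay in the set** (Hilbert-space Mazur):
if `v n ∈ S`, `S` closed and convex, and `⟪v n, z⟫ → ⟪b, z⟫` for every `z`, then `b ∈ S`.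
Proof by the projection `p` of `b` onto `S`: `⟪b − p, v n − p⟫ ≤ 0` passes to the limit and gives
`‖b − p‖² ≤ 0` (Brezis 2011, Thm. 3.7 with Thm. 5.2). [cite: Brezis2011, Thm. 3.7 (with Thm. 5.2)] -/
theorem mem_of_tendsto_inner_of_convex_isClosed {H : Type*} [NormedAddCommGroup H]
    [InnerProductSpace ℝ H] [CompleteSpace H] {S : Set H} (hS : Convex ℝ S) (hSc : IsClosed S)
    {v : ℕ → H} (hv : ∀ n, v n ∈ S) {b : H}
    (hw : ∀ z : H, Tendsto (fun n => ⟪v n, z⟫) atTop (𝓝 ⟪b, z⟫)) : b ∈ S := by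
  obtain ⟨p, hp, hpmin⟩ := exists_norm_eq_iInf_of_complete_convex ⟨v 0, hv 0⟩ hSc.isComplete hS b
  have hvar := (norm_eq_iInf_iff_real_inner_le_zero hS hp).1 hpmin
  have hlim : Tendsto (fun n => ⟪b - p, v n - p⟫) atTop (𝓝 ⟪b - p, b - p⟫) := by
    have h1 : ∀ x : H, ⟪b - p, x - p⟫ = ⟪x, b - p⟫ - ⟪p, b - p⟫ := fun x => by
      rw [real_inner_comm, inner_sub_left]
    simp_rw [h1]
    exact (hw (b - p)).sub_const _
  have hle : ⟪b - p, b - p⟫ ≤ 0 := le_of_tendsto' hlim fun n => hvar (v n) (hv n)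
  have h0 : b - p = 0 := real_inner_self_nonpos.1 hle
  rw [sub_eq_zero] at h0
  rwa [h0]

/-! ### The weight `(1 + |x|)⁻⁴` and the weighted `L²` space -/

/-- The weight `w(x) = (1 + |x|)⁻⁴` on `ℝ³` (positive, `≤ 1`, with `w ∈ L¹ ∩ L³`), used to embed
`L³(ℝ³; ℝ³)` into the separable Hilbert space `L²(w dx)`. [folklore] -/
def l3Weight (x : ℝ³) : ℝ≥0 := ⟨(1 + ‖x‖) ^ (-4 : ℝ), Real.rpow_nonneg (by positivity) _⟩

/-- Unfolding the weight. [folklore] -/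
theorem coe_l3Weight (x : ℝ³) : (l3Weight x : ℝ) = (1 + ‖x‖) ^ (-4 : ℝ) := rfl

/-- The weight is positive. [folklore] -/
theorem l3Weight_pos (x : ℝ³) : 0 < l3Weight x := by
  rw [← NNReal.coe_pos, coe_l3Weight]
  exact Real.rpow_pos_of_pos (by positivity) _

/-- The weight is at most `1`. [folklore] -/
theorem l3Weight_le_one (x : ℝ³) : l3Weight x ≤ 1 := by
  rw [← NNReal.coe_le_coe, coe_l3Weight, NNReal.coe_one]
  exact Real.rpow_le_one_of_one_le_of_nonpos (le_add_of_nonneg_right (norm_nonneg x)) (by norm_num)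

/-- The weight is continuous. [folklore] -/
theorem continuous_l3Weight : Continuous l3Weight :=
  ((continuous_const.add continuous_norm).rpow_const fun x =>
    Or.inl (add_pos_of_pos_of_nonneg one_pos (norm_nonneg x)).ne').subtype_mk _

/-- The weight is measurable. [folklore] -/
theorem measurable_l3Weight : Measurable l3Weight := continuous_l3Weight.measurable

/-- Powers of the weight are integrable: `∫ (1 + |x|)^{-4n} dx < ∞` for `n ≥ 1` (`4n > 3`;
Mathlib `integrable_one_add_norm`). [folklore] -/
theorem lintegral_l3Weight_pow_lt_top {n : ℕ} (hn : 1 ≤ n) :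
    ∫⁻ x, (l3Weight x : ℝ≥0∞) ^ n < ∞ := by
  have hr : (Module.finrank ℝ ℝ³ : ℝ) < 4 * n := by
    rw [finrank_euclideanSpace_fin]
    have : (1 : ℝ) ≤ n := by exact_mod_cast hn
    push_cast
    linarith
  have h := (integrable_one_add_norm (E := ℝ³) (μ := volume) hr).hasFiniteIntegral
  rw [hasFiniteIntegral_iff_enorm] at h
  refine lt_of_le_of_lt (le_of_eq (lintegral_congr fun x => ?_)) h
  have hb : 0 ≤ 1 + ‖x‖ := by positivity
  rw [Real.enorm_eq_ofReal (Real.rpow_nonneg hb _), ← ENNReal.coe_pow, ← ENNReal.ofReal_coe_nnreal,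
    NNReal.coe_pow, coe_l3Weight, ← Real.rpow_natCast, ← Real.rpow_mul hb]
  congr 2
  ring

/-- The weighted Lebesgue measure `w dx` on `ℝ³`. [folklore] -/
def l3μ : Measure ℝ³ := volume.withDensity fun x => (l3Weight x : ℝ≥0∞)

/-- `w dx` is a finite measure. [folklore] -/
theorem isFiniteMeasure_l3μ : IsFiniteMeasure l3μ := by
  refine ⟨?_⟩
  rw [l3μ, withDensity_apply _ MeasurableSet.univ, Measure.restrict_univ]
  simpa using lintegral_l3Weight_pow_lt_top (n := 1) le_rfl

/-- Lebesgue measure is absolutely continuous with respect to `w dx` (the weight is positive). [folklore] -/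
theorem volume_absolutelyContinuous_l3μ : (volume : Measure ℝ³) ≪ l3μ :=
  withDensity_absolutelyContinuous' measurable_l3Weight.coe_nnreal_ennreal.aemeasurable
    (Eventually.of_forall fun x => ENNReal.coe_ne_zero.2 (l3Weight_pos x).ne')

/-- `w dx` is absolutely continuous with respect to Lebesgue measure. [folklore] -/
theorem l3μ_absolutelyContinuous_volume : l3μ ≪ (volume : Measure ℝ³) :=
  withDensity_absolutelyContinuous _ _

/-- Lower integrals against `w dx`. [folklore] -/
theorem lintegral_l3μ_eq (g : ℝ³ → ℝ≥0∞) : ∫⁻ x, g x ∂l3μ = ∫⁻ x, (l3Weight x : ℝ≥0∞) * g x := by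
  rw [l3μ, lintegral_withDensity_eq_lintegral_mul_non_measurable _
    measurable_l3Weight.coe_nnreal_ennreal (Eventually.of_forall fun x => ENNReal.coe_lt_top)]
  rfl

/-- Bochner integrals against `w dx`. [folklore] -/
theorem integral_l3μ_eq {F : Type*} [NormedAddCommGroup F] [NormedSpace ℝ F] (g : ℝ³ → F) :
    ∫ x, g x ∂l3μ = ∫ x, (l3Weight x : ℝ) • g x := by
  rw [l3μ, integral_withDensity_eq_integral_smul measurable_l3Weight]
  rfl

/-- **Hölder**: `∫ w |f|² ≤ ‖f‖₃² ‖w‖₃` (exponents `3/2` and `3`). [folklore] -/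
theorem lintegral_l3Weight_mul_enorm_sq_le {f : ℝ³ → ℝ³} (hf : AEStronglyMeasurable f volume) :
    ∫⁻ x, (l3Weight x : ℝ≥0∞) * ‖f x‖ₑ ^ (2 : ℝ) ≤
      eLpNorm f 3 volume ^ 2 * (∫⁻ x, (l3Weight x : ℝ≥0∞) ^ 3) ^ (1 / 3 : ℝ) := by
  have hpq : Real.HolderConjugate (3 / 2) 3 := ⟨by norm_num, by norm_num, by norm_num⟩
  have h := ENNReal.lintegral_mul_le_Lp_mul_Lq volume hpq
    (f := fun x => ‖f x‖ₑ ^ (2 : ℝ)) (g := fun x => (l3Weight x : ℝ≥0∞))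
    (hf.enorm.pow_const _) measurable_l3Weight.coe_nnreal_ennreal.aemeasurable
  have e1 : ∀ x, (‖f x‖ₑ ^ (2 : ℝ)) ^ (3 / 2 : ℝ) = ‖f x‖ₑ ^ (3 : ℝ) := fun x => by
    rw [← ENNReal.rpow_mul]; norm_num
  have e3 : eLpNorm f 3 volume = (∫⁻ x, ‖f x‖ₑ ^ (3 : ℝ)) ^ (1 / 3 : ℝ) := by
    rw [eLpNorm_eq_lintegral_rpow_enorm_toReal (by norm_num) (by norm_num : (3 : ℝ≥0∞) ≠ ⊤)]
    simp only [ENNReal.toReal_ofNat, one_div]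
  have e2 : (∫⁻ x, ‖f x‖ₑ ^ (3 : ℝ)) ^ (1 / (3 / 2) : ℝ) = eLpNorm f 3 volume ^ 2 := by
    rw [e3, ← ENNReal.rpow_natCast, ← ENNReal.rpow_mul]
    norm_num
  have e4 : ∀ x, (l3Weight x : ℝ≥0∞) ^ (3 : ℝ) = (l3Weight x : ℝ≥0∞) ^ (3 : ℕ) := fun x => by
    rw [← ENNReal.rpow_natCast]; norm_num
  simp only [Pi.mul_apply, e1] at h
  rw [e2] at h
  simp_rw [e4] at h
  calc ∫⁻ x, (l3Weight x : ℝ≥0∞) * ‖f x‖ₑ ^ (2 : ℝ)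
      = ∫⁻ x, ‖f x‖ₑ ^ (2 : ℝ) * (l3Weight x : ℝ≥0∞) := lintegral_congr fun x => mul_comm _ _
    _ ≤ _ := h

/-- The constant `K = ‖w‖₃^{1/2}` of the embedding `L³(dx) ↪ L²(w dx)`. [folklore] -/
def l3K : ℝ≥0∞ := ((∫⁻ x, (l3Weight x : ℝ≥0∞) ^ 3) ^ (1 / 3 : ℝ)) ^ (1 / 2 : ℝ)

/-- `K < ∞`. [folklore] -/
theorem l3K_lt_top : l3K < ∞ :=
  ENNReal.rpow_lt_top_of_nonneg (by norm_num) (ENNReal.rpow_lt_top_of_nonneg (by norm_num)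
    (lintegral_l3Weight_pow_lt_top (n := 3) (by norm_num)).ne).ne

/-- **`L³(dx) ↪ L²(w dx)`**: `‖f‖_{L²(w dx)} ≤ K ‖f‖_{L³}`. [folklore] -/
theorem eLpNorm_two_l3μ_le {f : ℝ³ → ℝ³} (hf : AEStronglyMeasurable f volume) :
    eLpNorm f 2 l3μ ≤ eLpNorm f 3 volume * l3K := by
  rw [eLpNorm_eq_lintegral_rpow_enorm_toReal two_ne_zero ENNReal.ofNat_ne_top, lintegral_l3μ_eq]
  simp only [ENNReal.toReal_ofNat]
  calc (∫⁻ x, (l3Weight x : ℝ≥0∞) * ‖f x‖ₑ ^ (2 : ℝ)) ^ (1 / 2 : ℝ)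
      ≤ (eLpNorm f 3 volume ^ 2 * (∫⁻ x, (l3Weight x : ℝ≥0∞) ^ 3) ^ (1 / 3 : ℝ)) ^ (1 / 2 : ℝ) :=
        ENNReal.rpow_le_rpow (lintegral_l3Weight_mul_enorm_sq_le hf) (by norm_num)
    _ = eLpNorm f 3 volume * l3K := by
        rw [ENNReal.mul_rpow_of_nonneg _ _ (by norm_num : (0 : ℝ) ≤ 1 / 2), l3K]
        congr 1
        rw [← ENNReal.rpow_natCast, ← ENNReal.rpow_mul]
        norm_num

/-- An `L³(dx)` field is in `L²(w dx)`. [folklore] -/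
theorem memLp_two_l3μ {f : ℝ³ → ℝ³} (hf : MemLp f 3 volume) : MemLp f 2 l3μ :=
  ⟨hf.1.mono_ac l3μ_absolutelyContinuous_volume,
    lt_of_le_of_lt (eLpNorm_two_l3μ_le hf.1)
      (ENNReal.mul_lt_top hf.eLpNorm_lt_top l3K_lt_top)⟩

/-! ### The closed convex `L³`-ball inside `L²(w dx)` -/

/-- The elements of `L²(w dx)` whose `L³(dx)` norm is at most `M` (the `L³` norm of an element of
`L²(w dx)` is that of its representative; `w dx` and `dx` have the same null sets). [folklore] -/
def l3Ball (M : ℝ≥0) : Set (Lp ℝ³ 2 l3μ) := {f | eLpNorm (f : ℝ³ → ℝ³) 3 volume ≤ M}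

/-- Membership in the `L³`-ball. [folklore] -/
theorem mem_l3Ball {M : ℝ≥0} {f : Lp ℝ³ 2 l3μ} : f ∈ l3Ball M ↔ eLpNorm (f : ℝ³ → ℝ³) 3 volume ≤ M :=
  Iff.rfl

/-- Representatives of elements of `L²(w dx)` are measurable for Lebesgue measure. [folklore] -/
theorem aestronglyMeasurable_volume_of_Lp (f : Lp ℝ³ 2 l3μ) :
    AEStronglyMeasurable (f : ℝ³ → ℝ³) volume :=
  (Lp.aestronglyMeasurable f).mono_ac volume_absolutelyContinuous_l3μ

/-- The `L³`-ball is convex (Minkowski). [folklore] -/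
theorem convex_l3Ball (M : ℝ≥0) : Convex ℝ (l3Ball M) := by
  intro f hf g hg s t hs ht hst
  rw [mem_l3Ball] at hf hg ⊢
  have hae : ((s • f + t • g : Lp ℝ³ 2 l3μ) : ℝ³ → ℝ³) =ᵐ[volume]
      s • (f : ℝ³ → ℝ³) + t • (g : ℝ³ → ℝ³) :=
    volume_absolutelyContinuous_l3μ.ae_eq
      ((Lp.coeFn_add (s • f) (t • g)).trans ((Lp.coeFn_smul s f).add (Lp.coeFn_smul t g)))
  rw [eLpNorm_congr_ae hae]
  have hfm := aestronglyMeasurable_volume_of_Lp f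
  have hgm := aestronglyMeasurable_volume_of_Lp g
  calc eLpNorm (s • (f : ℝ³ → ℝ³) + t • (g : ℝ³ → ℝ³)) 3 volume
      ≤ eLpNorm (s • (f : ℝ³ → ℝ³)) 3 volume + eLpNorm (t • (g : ℝ³ → ℝ³)) 3 volume :=
        eLpNorm_add_le (hfm.const_smul s) (hgm.const_smul t) (by norm_num)
    _ = ENNReal.ofReal s * eLpNorm (f : ℝ³ → ℝ³) 3 volume +
          ENNReal.ofReal t * eLpNorm (g : ℝ³ → ℝ³) 3 volume := by
        rw [eLpNorm_const_smul, eLpNorm_const_smul, Real.enorm_eq_ofReal hs,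
          Real.enorm_eq_ofReal ht]
    _ ≤ ENNReal.ofReal s * M + ENNReal.ofReal t * M :=
        add_le_add (mul_le_mul' le_rfl hf) (mul_le_mul' le_rfl hg)
    _ = M := by
        rw [← add_mul, ← ENNReal.ofReal_add hs ht, hst, ENNReal.ofReal_one, one_mul]

/-- The `L³`-ball is closed in `L²(w dx)` (convergence in `L²(w dx)` gives a.e. convergence of a
subsequence, and the `L³` norm is lower semicontinuous under a.e. convergence, Fatou). [folklore] -/
theorem isClosed_l3Ball (M : ℝ≥0) : IsClosed (l3Ball M) := by
  refine isSeqClosed_iff_isClosed.1 fun f b hf hfb => ?_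
  rw [mem_l3Ball]
  have hmeas : TendstoInMeasure l3μ (fun n => (f n : ℝ³ → ℝ³)) atTop (b : ℝ³ → ℝ³) :=
    tendstoInMeasure_of_tendsto_Lp hfb
  obtain ⟨ns, -, hae⟩ := hmeas.exists_seq_tendsto_ae
  have haev : ∀ᵐ x ∂(volume : Measure ℝ³),
      Tendsto (fun i => (f (ns i) : ℝ³ → ℝ³) x) atTop (𝓝 ((b : ℝ³ → ℝ³) x)) :=
    volume_absolutelyContinuous_l3μ.ae_le hae
  refine (Lp.eLpNorm_lim_le_liminf_eLpNorm
    (fun i => aestronglyMeasurable_volume_of_Lp (f (ns i))) _ haev).trans ?_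
  exact Filter.liminf_le_of_frequently_le' (Frequently.of_forall fun i => (mem_l3Ball.1 (hf (ns i))))

/-- An `L³(dx)` field, viewed in `L²(w dx)`, lies in the `L³`-ball of its norm. [folklore] -/
theorem toLp_mem_l3Ball {f : ℝ³ → ℝ³} (hf : MemLp f 3 volume) {M : ℝ≥0}
    (hM : eLpNorm f 3 volume ≤ M) : (memLp_two_l3μ hf).toLp f ∈ l3Ball M := by
  rw [mem_l3Ball, eLpNorm_congr_ae (volume_absolutelyContinuous_l3μ.ae_eq (MemLp.coeFn_toLp _))]
  exact hM

/-! ### Pairings with compactly supported fields -/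

/-- A continuous compactly supported field divided by the weight is in `L²(w dx)`. [folklore] -/
theorem memLp_weightInv_smul {φ : ℝ³ → ℝ³} (hφ : Continuous φ) (hφc : HasCompactSupport φ) :
    MemLp (fun x => ((l3Weight x : ℝ)⁻¹) • φ x) 2 l3μ := by
  haveI : IsFiniteMeasure l3μ := isFiniteMeasure_l3μ
  have hc : Continuous fun x => ((l3Weight x : ℝ)⁻¹) • φ x :=
    ((NNReal.continuous_coe.comp continuous_l3Weight).inv₀ fun x =>
      NNReal.coe_ne_zero.2 (l3Weight_pos x).ne').smul hφ
  have hs : HasCompactSupport fun x => ((l3Weight x : ℝ)⁻¹) • φ x := by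
    refine hφc.mono fun x hx => ?_
    simp only [mem_support, ne_eq] at hx ⊢
    intro h0
    exact hx (by rw [h0, smul_zero])
  obtain ⟨C, hC⟩ := hs.exists_bound_of_continuous hc
  exact MemLp.of_bound hc.aestronglyMeasurable C (Eventually.of_forall hC)

/-- **The pairing of `L²(w dx)` with `φ/w` is the plain pairing with `φ`**:
`⟪g, φ/w⟫_{L²(w dx)} = ∫ ⟪g, φ⟫ dx`. [folklore] -/
theorem inner_toLp_weightInv_smul (g : Lp ℝ³ 2 l3μ) {φ : ℝ³ → ℝ³} (hφ : Continuous φ)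
    (hφc : HasCompactSupport φ) :
    ⟪g, (memLp_weightInv_smul hφ hφc).toLp _⟫ = ∫ x, ⟪(g : ℝ³ → ℝ³) x, φ x⟫ := by
  rw [MeasureTheory.L2.inner_def]
  have hae := MemLp.coeFn_toLp (memLp_weightInv_smul hφ hφc)
  calc ∫ x, ⟪(g : ℝ³ → ℝ³) x, ((memLp_weightInv_smul hφ hφc).toLp _ : ℝ³ → ℝ³) x⟫ ∂l3μ
      = ∫ x, ⟪(g : ℝ³ → ℝ³) x, ((l3Weight x : ℝ)⁻¹) • φ x⟫ ∂l3μ := by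
        refine integral_congr_ae ?_
        filter_upwards [hae] with x hx
        rw [hx]
    _ = ∫ x, (l3Weight x : ℝ) • ⟪(g : ℝ³ → ℝ³) x, ((l3Weight x : ℝ)⁻¹) • φ x⟫ := integral_l3μ_eq _
    _ = ∫ x, ⟪(g : ℝ³ → ℝ³) x, φ x⟫ := by
        refine integral_congr_ae (Eventually.of_forall fun x => ?_)
        have hw : (l3Weight x : ℝ) ≠ 0 := NNReal.coe_ne_zero.2 (l3Weight_pos x).ne'
        simp only [real_inner_smul_right, smul_eq_mul]
        field_simp

/-! ### The extraction -/

/-- **Weak compactness of `L³`-bounded sequences of fields** (sequential Banach–Alaoglu in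
`L³(ℝ³; ℝ³)`, tested against continuous compactly supported fields): if `a_k ∈ L³` with
`‖a_k‖₃ ≤ M`, then along a subsequence `∫⟪a_{σ(k)}, φ⟫ → ∫⟪a', φ⟫` for every continuous compactly
supported `φ`, for some `a' ∈ L³` with `‖a'‖₃ ≤ M` (weak lower semicontinuity of the norm;
Brezis 2011, Thm. 3.18 with Prop. 3.5 (iii), for the reflexive space `L³`). Proof through the
separable Hilbert space `L²((1+|x|)⁻⁴ dx) ⊇ L³(dx)` (Hölder), the weak compactness of its balls
(`exists_strictMono_tendsto_inner_of_norm_le`) and the weak closedness of the closed convex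
`L³`-ball (`mem_of_tendsto_inner_of_convex_isClosed`). [cite: Brezis2011, Thm. 3.18 with Prop. 3.5 (iii) and Thm. 3.7] -/
theorem exists_strictMono_tendsto_integral_inner_of_eLpNorm_three_le (M : ℝ≥0)
    (a : ℕ → ℝ³ → ℝ³) (ha : ∀ k, MemLp (a k) 3 volume) (hM : ∀ k, eLpNorm (a k) 3 volume ≤ M) :
    ∃ (σ : ℕ → ℕ) (a' : ℝ³ → ℝ³), StrictMono σ ∧ MemLp a' 3 volume ∧
      eLpNorm a' 3 volume ≤ M ∧
      ∀ φ : ℝ³ → ℝ³, Continuous φ → HasCompactSupport φ →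
        Tendsto (fun k => ∫ x, ⟪a (σ k) x, φ x⟫) atTop (𝓝 (∫ x, ⟪a' x, φ x⟫)) := by
  haveI : SFinite l3μ := by unfold l3μ; infer_instance
  haveI : Fact ((2 : ℝ≥0∞) ≠ ⊤) := ⟨ENNReal.ofNat_ne_top⟩
  -- the sequence in `H = L²(w dx)` and its bound
  set F : ℕ → Lp ℝ³ 2 l3μ := fun k => (memLp_two_l3μ (ha k)).toLp (a k) with hF
  set R : ℝ := ((M : ℝ≥0∞) * l3K).toReal with hR
  have hFR : ∀ k, ‖F k‖ ≤ R := fun k => by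
    rw [hF, Lp.norm_toLp, hR]
    refine ENNReal.toReal_mono (ENNReal.mul_ne_top ENNReal.coe_ne_top l3K_lt_top.ne) ?_
    exact (eLpNorm_two_l3μ_le (ha k).1).trans (mul_le_mul' (hM k) le_rfl)
  obtain ⟨σ, hσ, b, -, hw⟩ :=
    FunctionSpaces.exists_strictMono_tendsto_inner_of_norm_le (H := Lp ℝ³ 2 l3μ) hFR
  -- the weak limit stays in the `L³`-ball
  have hbS : b ∈ l3Ball M :=
    mem_of_tendsto_inner_of_convex_isClosed (convex_l3Ball M) (isClosed_l3Ball M)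
      (v := fun n => F (σ n)) (fun n => toLp_mem_l3Ball (ha (σ n)) (hM (σ n))) hw
  refine ⟨σ, (b : ℝ³ → ℝ³), hσ, ⟨aestronglyMeasurable_volume_of_Lp b,
    lt_of_le_of_lt (mem_l3Ball.1 hbS) ENNReal.coe_lt_top⟩, mem_l3Ball.1 hbS, ?_⟩
  intro φ hφ hφc
  have h := hw ((memLp_weightInv_smul hφ hφc).toLp _)
  rw [inner_toLp_weightInv_smul b hφ hφc] at h
  refine h.congr fun k => ?_
  rw [inner_toLp_weightInv_smul (F (σ k)) hφ hφc]
  refine integral_congr_ae ?_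
  filter_upwards [volume_absolutelyContinuous_l3μ.ae_eq (MemLp.coeFn_toLp (memLp_two_l3μ (ha (σ k))))]
    with x hx
  rw [hx]

/-- **Weak limits of weakly divergence-free fields are weakly divergence free** (the gradient of
a test function is a test field). [folklore] -/
theorem isWeaklyDivFree_of_tendsto_integral_inner {a : ℕ → ℝ³ → ℝ³} {a' : ℝ³ → ℝ³}
    (hdiv : ∀ k, IsWeaklyDivFree (a k))
    (hconv : ∀ φ : ℝ³ → ℝ³, FunctionSpaces.IsTestFunctionOn (⊤ : Opens ℝ³) φ →
      Tendsto (fun k => ∫ x, ⟪a k x, φ x⟫) atTop (𝓝 (∫ x, ⟪a' x, φ x⟫))) :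
    IsWeaklyDivFree a' := by
  intro θ hθ
  have h := hconv (gradient θ) (isTestFunctionOn_gradient_top hθ)
  have h0 : (fun k => ∫ x, ⟪a k x, gradient θ x⟫) = fun _ => (0 : ℝ) := funext fun k => hdiv k θ hθ
  rw [h0] at h
  exact tendsto_nhds_unique h tendsto_const_nhds

/-- **Weak compactness of `L³`-bounded, weakly divergence-free data** — the form consumed by the
limiting procedures of the local Leray theory (Jia–Šverák 2013, proof of Thm. 1: "`u₀^k ⇀ u₀` in
`L³`", "`‖u₀‖_{L³} ≤ liminf ‖u₀^k‖_{L³}`"; Seregin 2012 §3: "the weak `L₃(ℝ³)`-limit of the sequence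
`u^{(k)}(·, −S)`"): from `a_k ∈ L³` weakly divergence free with `‖a_k‖₃ ≤ M` one extracts a
subsequence converging against every test field to a weakly divergence-free `a' ∈ L³` with
`‖a'‖₃ ≤ M`. [cite: JiaSverak2013, proof of Thm. 1 (arXiv:1201.1592 p. 8: u₀^k ⇀ u₀ in L³, ‖u₀‖₃ ≤ liminf ‖u₀^k‖₃)] -/
theorem exists_strictMono_weakLimit_datum (M : ℝ≥0) (a : ℕ → ℝ³ → ℝ³)
    (ha : ∀ k, MemLp (a k) 3 volume ∧ IsWeaklyDivFree (a k) ∧ eLpNorm (a k) 3 volume ≤ M) :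
    ∃ (σ : ℕ → ℕ) (a' : ℝ³ → ℝ³), StrictMono σ ∧ MemLp a' 3 volume ∧ IsWeaklyDivFree a' ∧
      eLpNorm a' 3 volume ≤ M ∧
      ∀ φ : ℝ³ → ℝ³, FunctionSpaces.IsTestFunctionOn (⊤ : Opens ℝ³) φ →
        Tendsto (fun k => ∫ x, ⟪a (σ k) x, φ x⟫) atTop (𝓝 (∫ x, ⟪a' x, φ x⟫)) := by
  obtain ⟨σ, a', hσ, hmem, hle, hconv⟩ :=
    exists_strictMono_tendsto_integral_inner_of_eLpNorm_three_le M a (fun k => (ha k).1)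
      (fun k => (ha k).2.2)
  have hconv' : ∀ φ : ℝ³ → ℝ³, FunctionSpaces.IsTestFunctionOn (⊤ : Opens ℝ³) φ →
      Tendsto (fun k => ∫ x, ⟪a (σ k) x, φ x⟫) atTop (𝓝 (∫ x, ⟪a' x, φ x⟫)) :=
    fun φ hφ => hconv φ hφ.contDiff.continuous hφ.hasCompactSupport
  exact ⟨σ, a', hσ, hmem, isWeaklyDivFree_of_tendsto_integral_inner (a := fun k => a (σ k))
    (fun k => (ha (σ k)).2.1) hconv', hle, hconv'⟩

end Literature.Analysis.FluidPDE

end
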